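import Literature.Barriers.NavierStokesRegularity.NavierStokesInequalityArrangement
import HarnessLib

/-!
# Scheffer's operator `L` on separated products `f(r,z) = F₂(r) F₁(z)` (Ożański 2017, App. 8.1)

Barrier catalogue support file for `NavierStokesRegularity` (D-0021), on the discharge path of
fact C `NSIArrangementExists` of `NavierStokesInequalityArrangement` through Ożański's Theorem 6
(cut-off functions with `Lf > 0` near `∂U`; W. S. Ożański, arXiv:1709.00602, Appendix 8.1). The
proof of his Lemma 21 (the rectangle) takes `f(x₁,x₂) = f₁(x₁) f₂(x₂)` and uses
`Lf(x₁,x₂) = f₁''(x₁) f₂(x₂) + f₁(x₁) (f₂''(x₂) + f₂'(x₂)/x₂ - f₂(x₂)/x₂²)`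
("`= g₁(x₁) f₂(x₂) + f₁(x₁) g₂(x₂)`"). This file proves that identity for the tree's rendering
of `L` (`opL`, with the planar partials `derivR`, `derivZ` of `NavierStokesInequalityArrangement`;
meridian coordinates `q = (r, z)`, Ożański's `(x₂, x₁)`): for differentiable `G, F : ℝ → ℝ` and
`f(q) = G(q.1) F(q.2)`,
* `derivR_mul_sep`: `∂ᵣ f = G'(r) F(z)`, `derivZ_mul_sep`: `∂_z f = G(r) F'(z)` (as functions);
* `opL_mul_sep`: `L f (r,z) = F(z) (G''(r) + r⁻¹ G'(r) - G(r)/r²) + F''(z) G(r)` for `C²`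
  profiles.

## References

* W. S. Ożański, arXiv:1709.00602 (2017), Appendix 8.1, proof of Lemma 21 (the display
  `Lf = g₁ f₂ + f₁ g₂`). [`Ozanski2017NSISingular`]
-/

noncomputable section

open Set Function

namespace Literature.Barriers.NavierStokesRegularity

/-- The radial partial derivative of a separated product: `∂ᵣ (G(r) F(z)) = G'(r) F(z)`.
[cite: Ozanski2017NSISingular, Appendix 8.1 (proof of Lemma 21)] -/
theorem derivR_mul_sep {G F : ℝ → ℝ} (hG : Differentiable ℝ G) (hF : Differentiable ℝ F) :
    derivR (fun q : ℝ × ℝ => G q.1 * F q.2) = fun q => deriv G q.1 * F q.2 := by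
  funext q
  have hA : HasFDerivAt (fun q : ℝ × ℝ => G q.1) (deriv G q.1 • ContinuousLinearMap.fst ℝ ℝ ℝ) q :=
    (hG q.1).hasDerivAt.comp_hasFDerivAt q hasFDerivAt_fst
  have hB : HasFDerivAt (fun q : ℝ × ℝ => F q.2) (deriv F q.2 • ContinuousLinearMap.snd ℝ ℝ ℝ) q :=
    (hF q.2).hasDerivAt.comp_hasFDerivAt q hasFDerivAt_snd
  have h : HasFDerivAt (fun q : ℝ × ℝ => G q.1 * F q.2)
      (G q.1 • (deriv F q.2 • ContinuousLinearMap.snd ℝ ℝ ℝ) +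
        F q.2 • (deriv G q.1 • ContinuousLinearMap.fst ℝ ℝ ℝ)) q := hA.mul hB
  rw [derivR, h.fderiv]
  simp [mul_comm]

/-- The axial partial derivative of a separated product: `∂_z (G(r) F(z)) = G(r) F'(z)`.
[cite: Ozanski2017NSISingular, Appendix 8.1 (proof of Lemma 21)] -/
theorem derivZ_mul_sep {G F : ℝ → ℝ} (hG : Differentiable ℝ G) (hF : Differentiable ℝ F) :
    derivZ (fun q : ℝ × ℝ => G q.1 * F q.2) = fun q => G q.1 * deriv F q.2 := by
  funext q
  have hA : HasFDerivAt (fun q : ℝ × ℝ => G q.1) (deriv G q.1 • ContinuousLinearMap.fst ℝ ℝ ℝ) q :=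
    (hG q.1).hasDerivAt.comp_hasFDerivAt q hasFDerivAt_fst
  have hB : HasFDerivAt (fun q : ℝ × ℝ => F q.2) (deriv F q.2 • ContinuousLinearMap.snd ℝ ℝ ℝ) q :=
    (hF q.2).hasDerivAt.comp_hasFDerivAt q hasFDerivAt_snd
  have h : HasFDerivAt (fun q : ℝ × ℝ => G q.1 * F q.2)
      (G q.1 • (deriv F q.2 • ContinuousLinearMap.snd ℝ ℝ ℝ) +
        F q.2 • (deriv G q.1 • ContinuousLinearMap.fst ℝ ℝ ℝ)) q := hA.mul hB
  rw [derivZ, h.fderiv]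
  simp

/-- **`L` of a separated product** (Ożański 2017, App. 8.1, proof of Lemma 21:
`Lf = f₁''f₂ + f₁(f₂'' + f₂'/x₂ - f₂/x₂²)` for `f = f₁(x₁)f₂(x₂)`). In meridian coordinates,
for `C²` profiles `G` (radial, his `f₂`) and `F` (axial, his `f₁`) and `f(r,z) = G(r)F(z)`:
`(Lf)(r,z) = F(z) (G''(r) + r⁻¹G'(r) - G(r)/r²) + F''(z) G(r)`.
[cite: Ozanski2017NSISingular, Appendix 8.1 (proof of Lemma 21)] -/
theorem opL_mul_sep {G F : ℝ → ℝ} (hG : ContDiff ℝ 2 G) (hF : ContDiff ℝ 2 F) :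
    opL (fun q : ℝ × ℝ => G q.1 * F q.2) = fun q =>
      F q.2 * (deriv (deriv G) q.1 + (q.1)⁻¹ * deriv G q.1 - G q.1 / q.1 ^ 2) +
        deriv (deriv F) q.2 * G q.1 := by
  have hG1 : Differentiable ℝ G := hG.differentiable (by norm_num)
  have hF1 : Differentiable ℝ F := hF.differentiable (by norm_num)
  have hG2 : Differentiable ℝ (deriv G) := (hG.deriv' (n := 1)).differentiable (by norm_num)
  have hF2 : Differentiable ℝ (deriv F) := (hF.deriv' (n := 1)).differentiable (by norm_num)
  funext q
  rw [opL, derivR_mul_sep hG1 hF1, derivR_mul_sep hG2 hF1, derivZ_mul_sep hG1 hF1,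
    derivZ_mul_sep hG1 hF2]
  ring

end Literature.Barriers.NavierStokesRegularity
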